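import Summits.CriticalPhenomena.PercolationContinuityZ3.Theorems.FK.PressureElementaryBounds
import Literature.Probability.Percolation.SiteConnectionTools
import Literature.Probability.LatticeModels.GriffithsMonotonicity
import HarnessLib

/-!
# THE ZERO-TEMPERATURE LIMIT OF THE ISING PRESSURE AT `h = 0`: `0 ≤ ψ(β,0) − βd ≤ d log(1 + e^{−2β}) → 0`,
# BY THE PEIERLS COUNT "a configuration is determined up to a global flip by its unsatisfied edges";
# hence `ψ(β,h) − β(d + |h|) → 0` as `β → ∞` for EVERY `h`, and the nearest-neighbour correlations
# `⟨σ_0σ_{eᵢ}⟩^{∅/+}_{β,0} → 1` as `β → ∞`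
# (Friedli–Velenik 2017, §3.7.2 (Peierls' argument, Lemma 3.33 "contours determine the configuration") and Thm. 3.6;
# Simon 1993, §II.3)

Claimed R42 (8)(c) in the cell INBOX at 2026-08-29T04:00:50Z by fkp-10a gen 358 (NEW CLAIM #1 of the gen), addressed to coordinator fk-4 (next seated gen; gen 288 closed l.8706, (ι) in force); lineage row FO-10a-g358 (self-suggested), package g358-surface, label PS-C.
Helper file of the `fk-continuity` build cell (bschramm lane; `--supports stmt-CriticalPhenomena-4575`); builds on
p205010 (kernel theorem, internal audit signed; external expert review pending). No definitions, no named facts, no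
sorries; standard axioms. UNCONDITIONAL.

On a finite graph piece `(Λ, E_Λ)` whose induced graph is connected, the map `τ ↦ D(τ) = {e ∈ E_Λ : σ_e(τ) ≠ 1}` (the set
of unsatisfied edges) is at most two-to-one: `D(τ) = D(τ')` forces `τ_x τ'_x` to be constant along edges, hence constant,
so `τ' = ±τ` (`card_filter_unsatEdges_eq_le_two`). Since every bond is `±1` (Literature `bondSpin_eq_one_or`) and `Σ_{e∈E_Λ} σ_e = |E_Λ| − 2|D(τ)|`, the zero-field free
partition function is `Z^∅_{Λ;β,0} = e^{β|E_Λ|} Σ_τ e^{−2β|D(τ)|} ≤ 2 e^{β|E_Λ|} Σ_{S ⊆ E_Λ} e^{−2β|S|} = 2 e^{β|E_Λ|}(1 + e^{−2β})^{|E_Λ|}`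
(`isingPartitionFunction_free_zero_field_le`, every real `β`). The boxes `Λ_N ⊆ ℤ^d` are connected (Literature
`Percolation.box_induce_reachable`), `|E_{Λ_N}| ≤ d|Λ_N|`, `|Λ_N| → ∞` (`d ≥ 1`), so in the limit:

* **`pressure_zero_field_le`** — `ψ(β,0) ≤ βd + d log(1 + e^{−2β})` (`d ≥ 1`, every real `β`); with the lower bound
  `βd ≤ ψ(β,0)` of `PressureElementaryBounds`: `pressure_zero_field_sub_mem_Icc` — `0 ≤ ψ(β,0) − βd ≤ d log(1 + e^{−2β}) ≤ d e^{−2β}`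
  (every real `β`);
* **`tendsto_pressure_zero_field_sub_atTop`** — `ψ(β,0) − βd → 0` as `β → ∞`; together with the `h ≠ 0` case of
  `PressureElementaryBounds`: **`tendsto_pressure_sub_atTop_beta'`** — `ψ(β,h) − β(d + |h|) → 0` as `β → ∞` for EVERY `h`
  (the pressure minus the ground-state value vanishes at zero temperature; no residual entropy);
* **`tendsto_sum_freeCorr_nn_atTop`**, **`tendsto_freeCorr_nn_atTop`** / **`tendsto_plusCorr_nn_atTop`** — the zero-field
  nearest-neighbour correlations saturate: `⟨σ_0σ_{eᵢ}⟩^∅_{β,0} → 1` and `⟨σ_0σ_{eᵢ}⟩⁺_{β,0} → 1` as `β → ∞` (convexity: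
  `Σᵢ ⟨σ_0σ_{eᵢ}⟩^∅_β ≥ slope ψ(·,0) (β/2) β ≥ d − 2d log(1 + e^{−β})/β`, tree theorem `slope_pressure_beta_le_sum_freeCorr_nn`).

## References

* S. Friedli, Y. Velenik, *Statistical Mechanics of Lattice Systems*, CUP (2017), §3.7.2 (Peierls' argument; the
  contours / unsatisfied edges determine the configuration up to a global spin flip), Thm. 3.6, Exercise 3.3.
  [FriedliVelenik2017]
* R. Peierls, *On Ising's model of ferromagnetism*, Proc. Cambridge Philos. Soc. 32 (1936) 477–481. [Peierls1936]
* B. Simon, *The Statistical Mechanics of Lattice Gases* I, Princeton (1993), §II.3 (ground states, zero-temperature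
  limit). [Simon1993]
-/

noncomputable section

namespace Summit.CriticalPhenomena.PercolationContinuityZ3.Theorems.FK

namespace IsingPressure

open MeasureTheory Filter Topology Finset Set
open Literature.Probability.LatticeModels

variable {d : ℕ}

/-! ### The Peierls count on a connected finite graph piece -/

section FiniteVolume

variable {V : Type*} (G : SimpleGraph V) [DecidableEq V] [G.LocallyFinite]

omit [DecidableEq V] in
/-- The bond of the free glued configuration on an edge of `Λ`: `σ_{s(x,y)}(glue τ) = τ_x τ_y` (as reals) for
`x, y ∈ Λ`. [cite: FriedliVelenik2017, §3.1] -/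
theorem bondSpin_glue_free_mk {Λ : Finset V} (τ : Λ → ℤˣ) {x y : V} (hx : x ∈ Λ) (hy : y ∈ Λ) :
    bondSpin (glue Λ τ .free) s(x, y) = ((τ ⟨x, hx⟩ * τ ⟨y, hy⟩ : ℤˣ) : ℤ) := by
  rw [bondSpin_mk, spinAt, spinAt, glue_apply_of_mem Λ τ .free hx, glue_apply_of_mem Λ τ .free hy, Units.val_mul,
    Int.cast_mul]

/-- **"The unsatisfied edges determine the configuration up to a global flip"** (the injectivity behind Peierls'
argument): if the graph induced by `G` on `Λ` is connected, then for every set of edges `S` at most TWO configurations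
`τ : Λ → {±1}` have `{e ∈ E_Λ : σ_e(glue τ) ≠ 1} = S`. [cite: FriedliVelenik2017, §3.7.2 (Peierls' argument, Lemma 3.33)] -/
theorem card_filter_unsatEdges_eq_le_two {Λ : Finset V} (hconn : (G.induce (Λ : Set V)).Preconnected)
    (S : Finset (Sym2 V)) :
    #(univ.filter fun τ : Λ → ℤˣ => (edgesIn G Λ).filter (fun e => bondSpin (glue Λ τ .free) e ≠ 1) = S) ≤ 2 := by
  classical
  set F := univ.filter fun τ : Λ → ℤˣ => (edgesIn G Λ).filter (fun e => bondSpin (glue Λ τ .free) e ≠ 1) = S with hF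
  rcases F.eq_empty_or_nonempty with hF0 | ⟨τ₀, hτ₀⟩
  · rw [hF0]; simp
  -- every member of the fibre is `τ₀` or `-τ₀`
  have key : ∀ τ ∈ F, τ = τ₀ ∨ τ = -τ₀ := by
    intro τ hτ
    have hD : (edgesIn G Λ).filter (fun e => bondSpin (glue Λ τ .free) e ≠ 1) =
        (edgesIn G Λ).filter (fun e => bondSpin (glue Λ τ₀ .free) e ≠ 1) := by
      rw [(mem_filter.1 hτ).2, (mem_filter.1 hτ₀).2]
    -- equal bonds on every edge of `Λ`
    have hbond : ∀ e ∈ edgesIn G Λ, bondSpin (glue Λ τ .free) e = bondSpin (glue Λ τ₀ .free) e := by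
      intro e he
      have h1 := Finset.ext_iff.1 hD e
      simp only [mem_filter, he, true_and] at h1
      rcases bondSpin_eq_one_or (glue Λ τ .free) e with ha | ha <;>
        rcases bondSpin_eq_one_or (glue Λ τ₀ .free) e with hb | hb
      · rw [ha, hb]
      · exact absurd (h1.2 (by rw [hb]; norm_num)) (by rw [ha]; norm_num)
      · exact absurd (h1.1 (by rw [ha]; norm_num)) (by rw [hb]; norm_num)
      · rw [ha, hb]
    -- the ratio `ρ = τ τ₀` is constant along edges
    set ρ : Λ → ℤˣ := fun x => τ x * τ₀ x with hρ
    have hstep : ∀ u v : Λ, (G.induce (Λ : Set V)).Adj u v → ρ u = ρ v := by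
      intro u v huv
      have hadj : G.Adj (u : V) (v : V) := by simpa [SimpleGraph.comap_adj] using huv
      have he : s((u : V), (v : V)) ∈ edgesIn G Λ := by
        rw [mem_edgesIn_iff]
        refine ⟨hadj, fun z hz => ?_⟩
        rcases Sym2.mem_iff.1 hz with rfl | rfl
        · exact u.2
        · exact v.2
      have h := hbond _ he
      rw [bondSpin_glue_free_mk τ u.2 v.2, bondSpin_glue_free_mk τ₀ u.2 v.2] at h
      have h' : τ ⟨u, u.2⟩ * τ ⟨v, v.2⟩ = τ₀ ⟨u, u.2⟩ * τ₀ ⟨v, v.2⟩ := Units.ext (by exact_mod_cast h)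
      simp only [Subtype.coe_eta] at h'
      -- in `ℤˣ` every element squares to `1`
      change τ u * τ₀ u = τ v * τ₀ v
      calc τ u * τ₀ u = τ u * τ₀ u * (τ v * τ₀ v * (τ v * τ₀ v)) := by rw [Int.units_mul_self, mul_one]
        _ = (τ u * τ v) * (τ₀ u * τ₀ v) * (τ v * τ₀ v) := by simp only [mul_comm, mul_left_comm]
        _ = (τ₀ u * τ₀ v) * (τ₀ u * τ₀ v) * (τ v * τ₀ v) := by rw [h']
        _ = τ v * τ₀ v := by rw [Int.units_mul_self, one_mul]
    -- hence constant (connectedness)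
    have hconst : ∀ u v : Λ, ρ u = ρ v := by
      intro u v
      obtain ⟨p⟩ := hconn u v
      induction p with
      | nil => rfl
      | cons hadj _ ih => exact (hstep _ _ hadj).trans ih
    rcases Λ.eq_empty_or_nonempty with hΛ | ⟨x₀, hx₀⟩
    · left; funext x; exact absurd x.2 (by simp [hΛ])
    rcases Int.units_eq_one_or (ρ ⟨x₀, hx₀⟩) with h1 | h1
    · left
      funext x
      have hx : τ x * τ₀ x = 1 := (hconst x ⟨x₀, hx₀⟩).trans h1
      calc τ x = τ x * (τ₀ x * τ₀ x) := by rw [Int.units_mul_self, mul_one]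
        _ = τ₀ x := by rw [← mul_assoc, hx, one_mul]
    · right
      funext x
      have hx : τ x * τ₀ x = -1 := (hconst x ⟨x₀, hx₀⟩).trans h1
      calc τ x = τ x * (τ₀ x * τ₀ x) := by rw [Int.units_mul_self, mul_one]
        _ = (-τ₀) x := by rw [← mul_assoc, hx, Pi.neg_apply, neg_one_mul]
  calc #F ≤ #({τ₀, -τ₀} : Finset (Λ → ℤˣ)) :=
        card_le_card fun τ hτ => by rcases key τ hτ with rfl | rfl <;> simp
    _ ≤ 2 := card_le_two

/-- **The zero-field free partition function via unsatisfied edges**: with `E = E_Λ` and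
`D(τ) = {e ∈ E : σ_e ≠ 1}`, `Z^∅_{Λ;β,0} = Σ_τ exp(β(|E| − 2|D(τ)|))` (`σ_e = 1 − 2·𝟙_{D(τ)}(e)`).
[cite: FriedliVelenik2017, §3.7.2 (Peierls' argument) and §3.1, eq. (3.2)] -/
theorem isingPartitionFunction_free_zero_field_eq_sum (Λ : Finset V) (β : ℝ) :
    isingPartitionFunction G Λ β 0 .free =
      ∑ τ : Λ → ℤˣ, Real.exp (β * (#(edgesIn G Λ) -
        2 * #((edgesIn G Λ).filter (fun e => bondSpin (glue Λ τ .free) e ≠ 1)))) := by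
  classical
  rw [isingPartitionFunction_eq_sum_exp]
  refine sum_congr rfl fun τ _ => ?_
  congr 1
  have hsum : ∑ e ∈ edgesIn G Λ, bondSpin (glue Λ τ .free) e =
      #(edgesIn G Λ) - 2 * #((edgesIn G Λ).filter (fun e => bondSpin (glue Λ τ .free) e ≠ 1)) := by
    have h1 : ∀ e ∈ edgesIn G Λ, bondSpin (glue Λ τ .free) e =
        1 - 2 * (if bondSpin (glue Λ τ .free) e ≠ 1 then (1 : ℝ) else 0) := by
      intro e _
      rcases bondSpin_eq_one_or (glue Λ τ .free) e with h | h <;> norm_num [h]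
    rw [sum_congr rfl h1, sum_sub_distrib, ← mul_sum, sum_const, nsmul_eq_mul, mul_one, sum_boole]
  unfold isingHamiltonian
  rw [interactionEdges_free, zero_mul, sub_zero, hsum]
  ring

/-- **The Peierls bound on the zero-field free partition function**: if the graph induced on `Λ` is connected then,
for every real `β`, `Z^∅_{Λ;β,0} ≤ 2 e^{β|E_Λ|} (1 + e^{−2β})^{|E_Λ|}` (group the configurations by their set of
unsatisfied edges, at most two per set, and sum the binomial series over all subsets of `E_Λ`).
[cite: FriedliVelenik2017, §3.7.2 (Peierls' argument); Peierls1936] -/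
theorem isingPartitionFunction_free_zero_field_le {Λ : Finset V} (hconn : (G.induce (Λ : Set V)).Preconnected)
    (β : ℝ) :
    isingPartitionFunction G Λ β 0 .free ≤
      2 * Real.exp (β * #(edgesIn G Λ)) * (1 + Real.exp (-(2 * β))) ^ #(edgesIn G Λ) := by
  classical
  set E := edgesIn G Λ with hE
  set D : (Λ → ℤˣ) → Finset (Sym2 V) := fun τ => E.filter (fun e => bondSpin (glue Λ τ .free) e ≠ 1) with hDdef
  have hmaps : ∀ τ ∈ (univ : Finset (Λ → ℤˣ)), D τ ∈ E.powerset := fun τ _ =>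
    mem_powerset.2 (filter_subset _ _)
  -- rewrite `Z` and split fiberwise over the value of `D`
  have hZ : isingPartitionFunction G Λ β 0 .free =
      Real.exp (β * #E) * ∑ τ : Λ → ℤˣ, Real.exp (-(2 * β)) ^ #(D τ) := by
    rw [isingPartitionFunction_free_zero_field_eq_sum, mul_sum]
    refine sum_congr rfl fun τ _ => ?_
    rw [← Real.exp_nat_mul, ← Real.exp_add]
    congr 1
    simp only [hDdef, hE]
    ring
  have hfib : ∑ τ : Λ → ℤˣ, Real.exp (-(2 * β)) ^ #(D τ) =
      ∑ S ∈ E.powerset, ∑ τ ∈ univ.filter (fun τ => D τ = S), Real.exp (-(2 * β)) ^ #(D τ) :=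
    (sum_fiberwise_of_maps_to hmaps _).symm
  have hle : ∑ τ : Λ → ℤˣ, Real.exp (-(2 * β)) ^ #(D τ) ≤ ∑ S ∈ E.powerset, 2 * Real.exp (-(2 * β)) ^ #S := by
    rw [hfib]
    refine sum_le_sum fun S _ => ?_
    have hS : ∑ τ ∈ univ.filter (fun τ => D τ = S), Real.exp (-(2 * β)) ^ #(D τ) =
        #(univ.filter (fun τ => D τ = S)) * Real.exp (-(2 * β)) ^ #S := by
      rw [sum_congr rfl fun τ hτ => by rw [(mem_filter.1 hτ).2], sum_const, nsmul_eq_mul]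
    rw [hS]
    have h2 : (#(univ.filter (fun τ => D τ = S)) : ℝ) ≤ 2 := by
      exact_mod_cast card_filter_unsatEdges_eq_le_two G hconn S
    exact mul_le_mul_of_nonneg_right h2 (by positivity)
  have hbinom : ∑ S ∈ E.powerset, 2 * Real.exp (-(2 * β)) ^ #S = 2 * (1 + Real.exp (-(2 * β))) ^ #E := by
    rw [← mul_sum, add_comm, ← Finset.sum_pow_mul_eq_add_pow]
    congr 1
    exact sum_congr rfl fun S _ => by rw [one_pow, mul_one]
  rw [hZ]
  calc Real.exp (β * #E) * ∑ τ : Λ → ℤˣ, Real.exp (-(2 * β)) ^ #(D τ)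
      ≤ Real.exp (β * #E) * (2 * (1 + Real.exp (-(2 * β))) ^ #E) :=
        mul_le_mul_of_nonneg_left (hle.trans hbinom.le) (Real.exp_pos _).le
    _ = _ := by ring

/-- **`log Z^∅_{Λ;β,0} ≤ log 2 + β|E_Λ| + |E_Λ| log(1 + e^{−2β})`** on a connected piece (every real `β`).
[cite: FriedliVelenik2017, §3.7.2 (Peierls' argument); Peierls1936] -/
theorem log_isingPartitionFunction_free_zero_field_le {Λ : Finset V} (hconn : (G.induce (Λ : Set V)).Preconnected)
    (β : ℝ) :
    Real.log (isingPartitionFunction G Λ β 0 .free) ≤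
      Real.log 2 + β * #(edgesIn G Λ) + #(edgesIn G Λ) * Real.log (1 + Real.exp (-(2 * β))) := by
  have h1 : 0 < 1 + Real.exp (-(2 * β)) := by positivity
  have := Real.log_le_log (isingPartitionFunction_pos G Λ β 0 .free)
    (isingPartitionFunction_free_zero_field_le G hconn β)
  rwa [Real.log_mul (by positivity) (pow_pos h1 _).ne', Real.log_mul two_ne_zero (Real.exp_pos _).ne', Real.log_exp,
    Real.log_pow] at this

end FiniteVolume

/-! ### The boxes of `ℤ^d` -/

/-- The graph induced by `ℤ^d` on a box is connected (Literature `Percolation.box_induce_reachable`). [folklore] -/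
theorem box_induce_preconnected (L : ℕ) : ((zdGraph d).induce (↑(box d L) : Set (Site d))).Preconnected :=
  fun u v => Literature.Probability.Percolation.box_induce_reachable L u.2 v.2

/-- `|Λ_L| → ∞` for `d ≥ 1`. [folklore] -/
theorem tendsto_card_box_atTop (hd : 1 ≤ d) : Tendsto (fun L : ℕ => (#(box d L) : ℝ)) atTop atTop := by
  refine tendsto_atTop_mono (fun L => ?_) tendsto_natCast_atTop_atTop
  have h : L ≤ #(box d L) := by
    rw [card_box]
    exact (show L ≤ 2 * L + 1 by omega).trans (Nat.le_self_pow (by omega) _)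
  exact_mod_cast h

/-! ### Infinite volume: `ψ(β,0) − βd → 0` -/

/-- **`ψ(β,0) ≤ βd + d log(1 + e^{−2β})`** for `d ≥ 1` and every real `β` (Peierls bound in the boxes, `|E_{Λ_L}| ≤ d|Λ_L|`,
`log 2/|Λ_L| → 0`). [cite: FriedliVelenik2017, §3.7.2 and Thm. 3.6; Simon1993, §II.3] -/
theorem pressure_zero_field_le (hd : 1 ≤ d) (β : ℝ) :
    pressure d β 0 ≤ β * d + d * Real.log (1 + Real.exp (-(2 * β))) := by
  have hlim : Tendsto (fun L : ℕ => pressureIn (zdGraph d) (box d L) β 0 .free) atTop (𝓝 (pressure d β 0)) :=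
    hasBoxLimit_pressureIn_holds (d := d) β 0 .free
  set c : ℝ := β + Real.log (1 + Real.exp (-(2 * β))) with hc
  -- the upper bound `log 2 / |Λ_L| + c⁺ · d` where we bound `c |E|/|Λ|` by `max c 0 · d`
  have hup : Tendsto (fun L : ℕ => Real.log 2 / (#(box d L) : ℝ) + (β * d + d * Real.log (1 + Real.exp (-(2 * β)))))
      atTop (𝓝 (0 + (β * d + d * Real.log (1 + Real.exp (-(2 * β)))))) :=
    (tendsto_const_nhds.div_atTop (tendsto_card_box_atTop hd)).add tendsto_const_nhds
  rw [zero_add] at hup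
  -- case split on the sign of `c = β + log(1+e^{-2β})` (it is in fact always `≥ log 2 > 0`, but we do not need it)
  have hlog0 : 0 ≤ Real.log (1 + Real.exp (-(2 * β))) := Real.log_nonneg (by linarith [Real.exp_pos (-(2 * β))])
  have hcpos : 0 ≤ c := by
    -- `c = β + log(1+e^{-2β}) ≥ β + max(0, -2β) ≥ 0`... via `log(1+e^{-2β}) ≥ log(e^{-2β}) = -2β` and `≥ 0`
    have h1 : -(2 * β) ≤ Real.log (1 + Real.exp (-(2 * β))) := by
      have := Real.log_le_log (Real.exp_pos (-(2 * β))) (show Real.exp (-(2 * β)) ≤ 1 + Real.exp (-(2 * β)) by linarith)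
      rwa [Real.log_exp] at this
    rcases le_or_gt 0 β with hβ | hβ
    · exact add_nonneg hβ hlog0
    · rw [hc]; linarith
  refine le_of_tendsto_of_tendsto' hlim hup fun L => ?_
  have hpos : (0 : ℝ) < #(box d L) := by exact_mod_cast (box_nonempty d L).card_pos
  have h1 := log_isingPartitionFunction_free_zero_field_le (zdGraph d) (box_induce_preconnected (d := d) L) β
  have hE : (#(edgesIn (zdGraph d) (box d L)) : ℝ) ≤ d * #(box d L) := by
    exact_mod_cast card_edgesIn_le_mul_card (d := d) (box d L)
  rw [pressureIn, div_le_iff₀ hpos]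
  have h2 : β * #(edgesIn (zdGraph d) (box d L)) + #(edgesIn (zdGraph d) (box d L)) * Real.log (1 + Real.exp (-(2 * β)))
      = c * #(edgesIn (zdGraph d) (box d L)) := by rw [hc]; ring
  calc Real.log (isingPartitionFunction (zdGraph d) (box d L) β 0 .free)
      ≤ Real.log 2 + c * #(edgesIn (zdGraph d) (box d L)) := by linarith
    _ ≤ Real.log 2 + c * (d * #(box d L)) := by gcongr
    _ = (Real.log 2 / #(box d L) + (β * d + d * Real.log (1 + Real.exp (-(2 * β))))) * #(box d L) := by
        rw [hc]; field_simp

/-- **`0 ≤ ψ(β,0) − βd ≤ d log(1 + e^{−2β})`** (`d ≥ 1`, every real `β`). [cite: FriedliVelenik2017, §3.7.2 and Thm. 3.6; Simon1993, §II.3] -/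
theorem pressure_zero_field_sub_mem_Icc (hd : 1 ≤ d) (β : ℝ) :
    pressure d β 0 - β * d ∈ Icc 0 (d * Real.log (1 + Real.exp (-(2 * β)))) := by
  have h1 := mul_add_abs_le_pressure (d := d) β 0
  rw [abs_zero, add_zero] at h1
  have h2 := pressure_zero_field_le hd β
  exact ⟨by linarith, by linarith⟩

/-- `ψ(β,0) − βd ≤ d e^{−2β}` (`d ≥ 1`, every real `β`; `log(1 + t) ≤ t`). [cite: FriedliVelenik2017, §3.7.2 and Thm. 3.6] -/
theorem pressure_zero_field_sub_le_mul_exp (hd : 1 ≤ d) (β : ℝ) :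
    pressure d β 0 - β * d ≤ d * Real.exp (-(2 * β)) := by
  refine (pressure_zero_field_sub_mem_Icc hd β).2.trans (mul_le_mul_of_nonneg_left ?_ (Nat.cast_nonneg d))
  have := Real.log_le_sub_one_of_pos (show 0 < 1 + Real.exp (-(2 * β)) by positivity)
  linarith

/-- **`ψ(β,0) − βd → 0` as `β → ∞`** (`d ≥ 1`): no residual entropy at zero temperature in zero field.
[cite: FriedliVelenik2017, §3.7.2 and Thm. 3.6; Simon1993, §II.3] -/
theorem tendsto_pressure_zero_field_sub_atTop (hd : 1 ≤ d) :
    Tendsto (fun β => pressure d β 0 - β * d) atTop (𝓝 0) := by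
  have hexp : Tendsto (fun β : ℝ => (d : ℝ) * Real.exp (-(2 * β))) atTop (𝓝 ((d : ℝ) * 0)) :=
    (Real.tendsto_exp_atBot.comp (tendsto_neg_atTop_atBot.comp (tendsto_id.const_mul_atTop two_pos))).const_mul _
  rw [mul_zero] at hexp
  exact tendsto_of_tendsto_of_tendsto_of_le_of_le tendsto_const_nhds hexp
    (fun β => (pressure_zero_field_sub_mem_Icc hd β).1) fun β => pressure_zero_field_sub_le_mul_exp hd β

/-- **`ψ(β,h) − β(d + |h|) → 0` as `β → ∞`, for EVERY `h`** (`d ≥ 1`): the pressure approaches the ground-state value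
`β(d + |h|)` at zero temperature (`h ≠ 0`: `PressureElementaryBounds`; `h = 0`: the Peierls count above).
[cite: Simon1993, §II.3; FriedliVelenik2017, §3.7.2 and Exercise 3.3] -/
theorem tendsto_pressure_sub_atTop_beta' (hd : 1 ≤ d) (h : ℝ) :
    Tendsto (fun β => pressure d β h - β * (d + |h|)) atTop (𝓝 0) := by
  rcases eq_or_ne h 0 with rfl | hh
  · simpa using tendsto_pressure_zero_field_sub_atTop hd
  · exact tendsto_pressure_sub_atTop_beta hh

/-! ### The nearest-neighbour correlations saturate as `β → ∞` -/

/-- **`Σᵢ ⟨σ_0σ_{eᵢ}⟩^∅_{β,0} ≥ d − 2d log(1 + e^{−β})/β`** for `β > 0` (`d ≥ 1`): by convexity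
`Σᵢ ⟨σ_0σ_{eᵢ}⟩^∅_β ≥ slope ψ(·,0) (β/2) β` (tree theorem `slope_pressure_beta_le_sum_freeCorr_nn`), and the chord from
`β/2` to `β` has slope `≥ (βd − (βd/2 + d log(1 + e^{−β})))/(β/2)`. [cite: FriedliVelenik2017, §3.7.2 and Exercise 3.12; Lebowitz1977, §3, p. 470] -/
theorem sub_le_sum_freeCorr_nn (hd : 1 ≤ d) {β : ℝ} (hβ : 0 < β) :
    d - 2 * d * Real.log (1 + Real.exp (-β)) / β ≤ ∑ i, freeCorr d β 0 {0, Pi.single i 1} := by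
  have hslope := IsingEnergyDensity.slope_pressure_beta_le_sum_freeCorr_nn (d := d) hβ.le (show β / 2 < β by linarith)
  refine le_trans ?_ hslope
  have hlo := mul_add_abs_le_pressure (d := d) β 0
  rw [abs_zero, add_zero] at hlo
  have hup := pressure_zero_field_le hd (β / 2)
  rw [show -(2 * (β / 2)) = -β by ring] at hup
  rw [slope_def_field, le_div_iff₀ (by linarith : 0 < β - β / 2)]
  have : (d - 2 * d * Real.log (1 + Real.exp (-β)) / β) * (β - β / 2) =
      β * d - (β / 2 * d + d * Real.log (1 + Real.exp (-β))) := by field_simp; ring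
  rw [this]
  linarith

/-- **`Σᵢ ⟨σ_0σ_{eᵢ}⟩^∅_{β,0} → d` as `β → ∞`** (`d ≥ 1`). [cite: FriedliVelenik2017, §3.7.2 and Exercise 3.12; Simon1993, §II.3] -/
theorem tendsto_sum_freeCorr_nn_atTop (hd : 1 ≤ d) :
    Tendsto (fun β => ∑ i, freeCorr d β 0 ({0, Pi.single i 1} : Finset (Site d))) atTop (𝓝 d) := by
  have hlow : Tendsto (fun β : ℝ => (d : ℝ) - 2 * d * Real.log (1 + Real.exp (-β)) / β) atTop (𝓝 ((d : ℝ) - 0)) := by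
    refine tendsto_const_nhds.sub ?_
    have h1 : Tendsto (fun β : ℝ => 2 * (d : ℝ) * Real.log (1 + Real.exp (-β))) atTop (𝓝 (2 * d * Real.log (1 + 0))) :=
      ((((Real.tendsto_exp_atBot.comp tendsto_neg_atTop_atBot).const_add 1).log (by norm_num)).const_mul _)
    rw [add_zero, Real.log_one, mul_zero] at h1
    exact h1.div_atTop tendsto_id |>.congr fun β => rfl
  rw [sub_zero] at hlow
  refine tendsto_of_tendsto_of_tendsto_of_le_of_le' hlow tendsto_const_nhds ?_ ?_
  · filter_upwards [eventually_gt_atTop 0] with β hβ using sub_le_sum_freeCorr_nn hd hβ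
  · filter_upwards [eventually_ge_atTop 0] with β hβ
    calc ∑ i, freeCorr d β 0 ({0, Pi.single i 1} : Finset (Site d)) ≤ ∑ _i : Fin d, (1 : ℝ) :=
          sum_le_sum fun i _ => (freeCorr_le_plusCorr hβ le_rfl _).trans (plusCorr_le_one hβ le_rfl _)
      _ = d := by simp

/-- **`⟨σ_0σ_{eᵢ}⟩^∅_{β,0} → 1` as `β → ∞`** for every direction `i` (`d ≥ 1`): each term is `≤ 1` and their sum tends to
`d`. [cite: FriedliVelenik2017, §3.7.2 and Exercise 3.12; Simon1993, §II.3] -/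
theorem tendsto_freeCorr_nn_atTop (hd : 1 ≤ d) (i : Fin d) :
    Tendsto (fun β => freeCorr d β 0 ({0, Pi.single i 1} : Finset (Site d))) atTop (𝓝 1) := by
  have hsum := tendsto_sum_freeCorr_nn_atTop hd
  -- `f_i = Σ_j f_j − Σ_{j ≠ i} f_j ≥ Σ_j f_j − (d − 1)`
  have hlow : Tendsto (fun β : ℝ => (∑ j, freeCorr d β 0 ({0, Pi.single j 1} : Finset (Site d))) - (d - 1)) atTop
      (𝓝 ((d : ℝ) - (d - 1))) := hsum.sub tendsto_const_nhds
  rw [show (d : ℝ) - (d - 1) = 1 by ring] at hlow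
  refine tendsto_of_tendsto_of_tendsto_of_le_of_le' hlow tendsto_const_nhds ?_ ?_
  · filter_upwards [eventually_ge_atTop 0] with β hβ
    have hsplit := (sum_erase_add univ (fun j => freeCorr d β 0 ({0, Pi.single j 1} : Finset (Site d))) (mem_univ i))
    have hrest : ∑ j ∈ univ.erase i, freeCorr d β 0 ({0, Pi.single j 1} : Finset (Site d)) ≤ (d : ℝ) - 1 := by
      calc ∑ j ∈ univ.erase i, freeCorr d β 0 ({0, Pi.single j 1} : Finset (Site d)) ≤ ∑ _j ∈ univ.erase i, (1 : ℝ) :=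
            sum_le_sum fun j _ => (freeCorr_le_plusCorr hβ le_rfl _).trans (plusCorr_le_one hβ le_rfl _)
        _ = (d : ℝ) - 1 := by
            rw [sum_const, nsmul_eq_mul, mul_one, card_erase_of_mem (mem_univ i), card_univ, Fintype.card_fin,
              Nat.cast_sub hd, Nat.cast_one]
    linarith
  · filter_upwards [eventually_ge_atTop 0] with β hβ using
      (freeCorr_le_plusCorr hβ le_rfl _).trans (plusCorr_le_one hβ le_rfl _)

/-- **`⟨σ_0σ_{eᵢ}⟩⁺_{β,0} → 1` as `β → ∞`** (`d ≥ 1`; `⟨·⟩^∅ ≤ ⟨·⟩⁺ ≤ 1`, GKS). [cite: FriedliVelenik2017, §3.7.2 and Exercise 3.12; Simon1993, §II.3] -/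
theorem tendsto_plusCorr_nn_atTop (hd : 1 ≤ d) (i : Fin d) :
    Tendsto (fun β => plusCorr d β 0 ({0, Pi.single i 1} : Finset (Site d))) atTop (𝓝 1) := by
  refine tendsto_of_tendsto_of_tendsto_of_le_of_le' (tendsto_freeCorr_nn_atTop hd i) tendsto_const_nhds ?_ ?_
  · filter_upwards [eventually_ge_atTop 0] with β hβ using freeCorr_le_plusCorr hβ le_rfl _
  · filter_upwards [eventually_ge_atTop 0] with β hβ using plusCorr_le_one hβ le_rfl _

/-- **`Σᵢ ⟨σ_0σ_{eᵢ}⟩⁺_{β,0} → d` as `β → ∞`** (`d ≥ 1`): the plus-state nearest-neighbour energy per site tends to the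
ground-state energy `−d`. [cite: FriedliVelenik2017, §3.7.2 and Exercise 3.12; Simon1993, §II.3] -/
theorem tendsto_sum_plusCorr_nn_atTop (hd : 1 ≤ d) :
    Tendsto (fun β => ∑ i, plusCorr d β 0 ({0, Pi.single i 1} : Finset (Site d))) atTop (𝓝 d) := by
  have := tendsto_finsetSum (univ : Finset (Fin d)) fun i _ => tendsto_plusCorr_nn_atTop (d := d) hd i
  simpa using this

end IsingPressure

end Summit.CriticalPhenomena.PercolationContinuityZ3.Theorems.FK

end
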